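/-
Copyright (c) 2026. All rights reserved.
Released under Apache 2.0 license as described in the file LICENSE.
-/
import Summits.CriticalPhenomena.LaceExpansionHighD.NobleBoundsNMidSCornerLetter
import HarnessLib

/-!
# Fitzner–van der Hofstad (2017), Prop. 5.5 (5.34) at `N = M + 2` against the SHARP blocks, hypothesis-free — Part I
§D: the corner `w_{k+1} = t_k` (`R′`) cell packages of a MIDDLE junction against `A♯` (cells `(a,0,a′)`, `(a,1,a′)`,
`(a,2,a′)` and their dispatcher; bodies = the off-corner `F‴` packages of `NobleBoundsNMidSOpen` verbatim except for
the exit letter) (WHAT-IF, DIVERGENCE D77; b2b-lace LEMMAS node N76-X2-D77, module 2/11)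

[FvdH17] = R. Fitzner, R. van der Hofstad, *Mean-field behavior for nearest-neighbor percolation in `d > 10`*,
arXiv:1506.07977v2 (EJP 22 (2017), paper 43).  Page numbers refer to the arXiv version.

SPLIT PROVENANCE: module 2 of 11 of the b2b-lace node N76-X2-D77 (what-if, DIVERGENCE D77) — the 11 modules are the
section-seam split (carver-g217, 2026-08-27) of the single-module form `NobleBoundsNSharpD77.lean` (carver-g51
text-final, sha256 `877e12977f9f9c92`, 2707 lines): every declaration, statement and proof is carried over verbatim and
in the original order; only module boundaries, the repeated `section`/`variable` headers and two docstrings were added.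
PLACEMENT: what-if objects of `NobleBlocksSharp` (b2b-lace LEAN PLACEMENT RULE, REFEREE R491), hence
`namespace Summit.CriticalPhenomena.LaceExpansionHighD.NobleBlocks`.  Conventions: `d`-generic; every declaration
carries its [FvdH17] display / page cite in the docstring; NOTHING is cited as a fact (b2b-lace ABSOLUTE RULE);
additive (no existing declaration is changed). -/

noncomputable section

namespace Summit.CriticalPhenomena.LaceExpansionHighD.NobleBlocks

open Literature.Probability.FitznerVanDerHofstad2017 Literature.Probability.FitznerVanDerHofstad2017.NobleBlocks
open Literature.Probability.FitznerVanDerHofstad2017.NobleBlocks.LenIdx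
open Literature.Probability.LatticeModels Literature.Probability.Percolation
open Literature.Probability.FitznerVanDerHofstad2017.BlockSummation
open Literature.Barriers.CriticalPhenomena
open Literature.Combinatorics.SimpleGraph _root_.SimpleGraph _root_.MeasureTheory
open scoped BigOperators ENNReal Matrix

variable {d : ℕ}

/-! ### D. The MIDDLE junction on the corner `w_{k+1} = t_k` -/

section Packages

variable (p : unitInterval) (M : ℕ) (x : Site d) (b : Fin (M + 2) → Site d × Site d) (w t z : Fin (M + 2) → Site d)
  (a : Fin (M + 2) → Fin 3 ⊕ Unit) (c : Fin 3 ⊕ Unit) (τ : Fin (M + 1) → Bool × Fin 3)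

/-- **Cells `(a, 0, a′)`, `a ∈ {0,1,2}`, `a′ ∈ {1,2}`, variant `F‴`, ON THE CORNER `w′ = t`, against the PRIMED
entry letter**: a package with target `A'^{κ,a,0,*}(u_k,w_k,t_k,z_k) · A♯^{0,a′}(t_k,z_k,w_{k+1},u_{k+1})`
(residue `R′`, inner class `0`: `z = t`, the second factor is the closed bubble `t →(j_{a′}) u′ →(≥1) t`).
[cite: FitznerVanDerHofstad2017, §6.1 (6.4), "Case a = 0 / 1 / ≥ 2", "Case b = 1, ≥ 2" (arXiv:1506.07977v2 pp. 58–59); §5.1 (5.4) (p. 48); App. B (pp. 74–75); §4.4 (4.61), (4.64), text after (4.66) (pp. 41–42)] -/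
theorem nonempty_jPkg_midS_zero_corner' (i i₀ : Fin (M + 1)) (hk : i₀.succ = i.castSucc) (κ : Fin d × Bool)
    (hb : (b i.castSucc).2 = (b i.castSucc).1 + stepVec κ) (hσ : (τ i).1 = false) (hc0 : (τ i).2 = 0)
    (a₀ : Fin 3) (ha : a i.castSucc = Sum.inl a₀) {a' : Fin 3} (ha' : a i.succ = Sum.inl a') (ha'0 : a' ≠ 0)
    (hwt : w i.succ = t i.castSucc) :
    Nonempty (JPkg p (jctx M x b w t z a τ i.castSucc) (JFacts M x b w t z a c τ)
      (blockAiotaSt' (Letters.perc d p) κ a₀ 0 (b i.castSucc).1 (w i.castSucc) (t i.castSucc) (z i.castSucc) *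
        blockASharp (Letters.perc d p) 0 a' (t i.castSucc) (z i.castSucc) (w i.succ) (b i.succ).1)) := by
  -- degenerate parameters: the piece is empty
  by_cases hP : (t i.castSucc ≠ (b i.succ).1 ∧ (a' ≠ 0 → w i.succ ≠ (b i.succ).1) ∧
      ((τ i).2 = 0 → t i.castSucc = z i.castSucc) ∧ ((τ i).2 = 1 → (zdGraph d).Adj (t i.castSucc) (z i.castSucc))) ∧
      (b i.castSucc).1 ≠ t i.castSucc ∧ (b i.castSucc).1 ≠ z i.castSucc ∧ (b i.castSucc).2 ≠ z i.castSucc ∧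
      (a₀ = 0 → w i.castSucc = (b i.castSucc).1) ∧ (a₀ = 1 → (zdGraph d).Adj (b i.castSucc).1 (w i.castSucc))
  swap
  · refine ⟨JPkg.vacuous p _ _ (fun ω K₀ hF => hP ?_) _⟩
    obtain ⟨-, hty, hut, huz, hvz, hw0, hw1, hw', -, hc0', -, hc1, -⟩ := midSOpen_facts hF i i₀ hk hσ ha ha'
    exact ⟨⟨hty, hw', hc0', fun h => (hc1 h).1⟩, hut, huz, hvz, hw0, hw1⟩
  obtain ⟨hQ, hut, huz, hvz, hw0, hw1⟩ := hP
  have htz : t i.castSucc = z i.castSucc := hQ.2.2.1 hc0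
  obtain ⟨E3, E4, f3, f4, hmem₂, hrow₂⟩ :=
    midS_cornerLetter_piPerc p M x b w t z a c τ i hσ ha' ha'0 0 hwt hQ hc0
  refine nonempty_jPkg_midSOpen_core p M x b w t z a τ c i i₀ hk κ hb hσ ha ha'
    (event (ge 1) (b i.castSucc).2 (t i.castSucc)) Set.univ Set.univ E3 E4
    (endX a₀ (b i.castSucc).1 (w i.castSucc) (z i.castSucc))
    (isFinitary_event _ _ _) isFinitary_univ isFinitary_univ f3 f4 (isFinitary_endX _ _ _ _)
    (fun ω K₀ hF => ⟨?_, Set.mem_univ _, Set.mem_univ _, (hmem₂ ω K₀ hF).1, (hmem₂ ω K₀ hF).2,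
      midSOpen_exit_mem M x b w t z a c τ hF i i₀ hk ha huz hw0⟩) ?_ 
        ((junF_midSCorner_up_le₂ p M x b w t z a τ i hσ ha' _ _ _ _ _ _ _).trans hrow₂)
  · obtain ⟨h0, -⟩ := hF.conn_midS i hσ ha'
    rw [event_ge]; exact mem_openConnGe_one_of_ne h0 (by rw [htz]; exact hvz)
  · refine (junF_midSOpen_xb_le₃ p M x b w t z a τ i i₀ hk hσ ha ha' _ _ _ _ _ _ _).trans ?_
    rw [← htz]
    unfold endX
    split_ifs with h0
    · subst h0
      rw [hw0 rfl]
      exact piPerc_midS_zero_zero_le_blockAiotaSt' p hb (by rw [htz]; exact hvz.symm) (fun h => hut h.symm) _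
    · obtain h1 | h2 : a₀ = 1 ∨ a₀ = 2 := by
        fin_cases a₀
        · exact absurd rfl h0
        · exact Or.inl rfl
        · exact Or.inr rfl
      · subst h1
        obtain ⟨κ', hκ'⟩ := (zdGraph_adj_iff_stepVec _ _).1 (hw1 rfl)
        rw [blockAiotaSt'_of_ne _ _ (fun h => absurd h.1 (by decide))]
        exact piPerc_midS_one_zero_le_blockAiotaSt p hb hκ' (fun h => hut h.symm) _
      · subst h2
        rw [blockAiotaSt'_of_ne _ _ (fun h => absurd h.1 (by decide))]
        exact piPerc_midS_two_zero_le_blockAiotaSt p hb _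

/-- **Cells `(a, 1, a′)`, `a ∈ {0,1,2}`, `a′ ∈ {1,2}`, variant `F‴`, ON THE CORNER `w′ = t`**: a package with
target `A^{κ,a,1,*}(u_k,w_k,t_k,z_k) · A♯^{1,a′}(t_k,z_k,w_{k+1},u_{k+1})` (residue `R′`, inner class `1`: the
sausage line is the open bond `{t ←1̲→ z}` itself, the second factor the bubble `t →(j_{a′}) u′ →(≥1) z`).
[cite: FitznerVanDerHofstad2017, §6.1 (6.4), "Case a = 0 / 1 / ≥ 2", "Case b = 1, ≥ 2" (arXiv:1506.07977v2 pp. 58–59); §5.1 (5.4) (p. 48); App. B (pp. 74–75); §4.4 (4.61), (4.64), text after (4.66) (pp. 41–42)] -/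
theorem nonempty_jPkg_midS_one_corner (i i₀ : Fin (M + 1)) (hk : i₀.succ = i.castSucc) (κ : Fin d × Bool)
    (hb : (b i.castSucc).2 = (b i.castSucc).1 + stepVec κ) (hσ : (τ i).1 = false) (hc1 : (τ i).2 = 1)
    (a₀ : Fin 3) (ha : a i.castSucc = Sum.inl a₀) {a' : Fin 3} (ha' : a i.succ = Sum.inl a') (ha'0 : a' ≠ 0)
    (hwt : w i.succ = t i.castSucc) :
    Nonempty (JPkg p (jctx M x b w t z a τ i.castSucc) (JFacts M x b w t z a c τ)
      (blockAiotaSt (Letters.perc d p) κ a₀ 1 (b i.castSucc).1 (w i.castSucc) (t i.castSucc) (z i.castSucc) *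
        blockASharp (Letters.perc d p) 1 a' (t i.castSucc) (z i.castSucc) (w i.succ) (b i.succ).1)) := by
  -- degenerate parameters: the piece is empty
  by_cases hP : (t i.castSucc ≠ (b i.succ).1 ∧ (a' ≠ 0 → w i.succ ≠ (b i.succ).1) ∧
      ((τ i).2 = 0 → t i.castSucc = z i.castSucc) ∧ ((τ i).2 = 1 → (zdGraph d).Adj (t i.castSucc) (z i.castSucc))) ∧
      (b i.castSucc).1 ≠ t i.castSucc ∧ (b i.castSucc).1 ≠ z i.castSucc ∧ (b i.castSucc).2 ≠ z i.castSucc ∧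
      (a₀ = 0 → w i.castSucc = (b i.castSucc).1) ∧ (a₀ = 1 → (zdGraph d).Adj (b i.castSucc).1 (w i.castSucc)) ∧
      t i.castSucc ≠ z i.castSucc
  swap
  · refine ⟨JPkg.vacuous p _ _ (fun ω K₀ hF => hP ?_) _⟩
    obtain ⟨-, hty, hut, huz, hvz, hw0, hw1, hw', -, hc0', hcn, hc1', -⟩ := midSOpen_facts hF i i₀ hk hσ ha ha'
    exact ⟨⟨hty, hw', hc0', fun h => (hc1' h).1⟩, hut, huz, hvz, hw0, hw1, hcn (by rw [hc1]; decide)⟩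
  obtain ⟨hQ, hut, huz, hvz, hw0, hw1, htz⟩ := hP
  have hadj : (zdGraph d).Adj (t i.castSucc) (z i.castSucc) := hQ.2.2.2 hc1
  obtain ⟨E3, E4, f3, f4, hmem₂, hrow₂⟩ :=
    midS_cornerLetter_piPerc p M x b w t z a c τ i hσ ha' ha'0 1 hwt hQ hc1
  -- the open sausage bond is its own witness
  have hbond : ∀ ω K₀, JFacts M x b w t z a c τ ω K₀ →
      K₀ i.castSucc.succ 1 ∈ (event (eq 1) (t i.castSucc) (z i.castSucc) : Set (BondConfig (Site d))) := by
    intro ω K₀ hF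
    rw [hF.tz_witness_midS i hσ ha' htz ((midSOpen_facts hF i i₀ hk hσ ha ha').2.2.2.2.2.2.2.2.2.2.2.1 hc1).2]
    exact singleton_mem_event_eq_one htz
  by_cases h0 : a₀ = 0
  · subst h0
    have hwu : w i.castSucc = (b i.castSucc).1 := hw0 rfl
    by_cases hx : t i.castSucc = (b i.castSucc).2
    · -- sub-row `x = e`: triangle, exit line of length `≥ 2` by parity
      refine nonempty_jPkg_midSOpen_core p M x b w t z a τ c i i₀ hk κ hb hσ ha ha' Set.univ
        (event (eq 1) (t i.castSucc) (z i.castSucc)) Set.univ E3 E4 (event (ge 2) (z i.castSucc) (b i.castSucc).1)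
        isFinitary_univ (isFinitary_event _ _ _) isFinitary_univ f3 f4 (isFinitary_event _ _ _)
        (fun ω K₀ hF => ⟨Set.mem_univ _, hbond ω K₀ hF, Set.mem_univ _, (hmem₂ ω K₀ hF).1,
          (hmem₂ ω K₀ hF).2, ?_⟩) ?_ 
        ((junF_midSCorner_up_le₂ p M x b w t z a τ i hσ ha' _ _ _ _ _ _ _).trans hrow₂)
      · have h5 := hF.conn_exit i i₀ hk ha
        rw [hwu] at h5
        have hadj' : (zdGraph d).Adj (b i.castSucc).1 (b i.castSucc).2 :=
          (zdGraph_adj_iff_stepVec _ _).2 ⟨κ, hb⟩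
        have hna : ¬ (zdGraph d).Adj (b i.castSucc).1 (z i.castSucc) :=
          not_adj_of_adj_adj hadj' (by rw [← hx]; exact hadj)
        rw [event_comm, event_ge]
        refine mem_openConnGe_two_of_notMem h5 huz fun hm => hna ?_
        exact (SimpleGraph.mem_edgeSet _).1 (hF.lattice _ (hF.witness_subset _ 5 hm))
      · refine (junF_midSOpen_xb_le₃' p M x b w t z a τ i i₀ hk hσ ha ha' _ _ _ _ _ _ _).trans ?_
        rw [hwu, hx]
        exact piPerc_midS_zero_one_e_le_blockAiotaSt p hb (fun h => huz h.symm) _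
    · -- sub-row `x ≠ e`: square
      refine nonempty_jPkg_midSOpen_core p M x b w t z a τ c i i₀ hk κ hb hσ ha ha'
        (event (ge 1) (b i.castSucc).2 (t i.castSucc)) (event (eq 1) (t i.castSucc) (z i.castSucc)) Set.univ E3 E4
        (event (ge 1) (z i.castSucc) (b i.castSucc).1)
        (isFinitary_event _ _ _) (isFinitary_event _ _ _) isFinitary_univ f3 f4 (isFinitary_event _ _ _)
        (fun ω K₀ hF => ⟨?_, hbond ω K₀ hF, Set.mem_univ _, (hmem₂ ω K₀ hF).1, (hmem₂ ω K₀ hF).2, ?_⟩)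
        ?_ 
        ((junF_midSCorner_up_le₂ p M x b w t z a τ i hσ ha' _ _ _ _ _ _ _).trans hrow₂)
      · obtain ⟨h0', -⟩ := hF.conn_midS i hσ ha'
        rw [event_ge]; exact mem_openConnGe_one_of_ne h0' (fun h => hx h.symm)
      · have h5 := midSOpen_exit_mem M x b w t z a c τ hF i i₀ hk ha huz hw0
        rwa [endX, if_pos rfl] at h5
      · refine (junF_midSOpen_xb_le₄ p M x b w t z a τ i i₀ hk hσ ha ha' _ _ _ _ _ _ _).trans ?_
        rw [hwu]
        exact piPerc_midS_zero_one_ne_le_blockAiotaSt p hb (fun h => huz h.symm) _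
  · refine nonempty_jPkg_midSOpen_core p M x b w t z a τ c i i₀ hk κ hb hσ ha ha'
      (event (ge 0) (b i.castSucc).2 (t i.castSucc)) (event (eq 1) (t i.castSucc) (z i.castSucc)) Set.univ E3 E4
      (endX a₀ (b i.castSucc).1 (w i.castSucc) (z i.castSucc))
      (isFinitary_event _ _ _) (isFinitary_event _ _ _) isFinitary_univ f3 f4 (isFinitary_endX _ _ _ _)
      (fun ω K₀ hF => ⟨?_, hbond ω K₀ hF, Set.mem_univ _, (hmem₂ ω K₀ hF).1, (hmem₂ ω K₀ hF).2,
        midSOpen_exit_mem M x b w t z a c τ hF i i₀ hk ha huz hw0⟩) ?_ 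
        ((junF_midSCorner_up_le₂ p M x b w t z a τ i hσ ha' _ _ _ _ _ _ _).trans hrow₂)
    · obtain ⟨h0', -⟩ := hF.conn_midS i hσ ha'
      rw [event_ge]; exact mem_openConnGe_zero_of_mem h0'
    · refine (junF_midSOpen_xb_le₄ p M x b w t z a τ i i₀ hk hσ ha ha' _ _ _ _ _ _ _).trans ?_
      rw [endX, if_neg h0]
      obtain h1 | h2 : a₀ = 1 ∨ a₀ = 2 := by
        fin_cases a₀
        · exact absurd rfl h0
        · exact Or.inl rfl
        · exact Or.inr rfl
      · subst h1
        obtain ⟨κ', hκ'⟩ := (zdGraph_adj_iff_stepVec _ _).1 (hw1 rfl)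
        exact piPerc_midS_one_one_le_blockAiotaSt p hb hκ' _
      · subst h2
        exact piPerc_midS_two_one_le_blockAiotaSt p hb _

/-- **Cells `(a, 2, a′)`, `a ∈ {0,1,2}`, `a′ ∈ {1,2}`, variant `F‴`, ON THE CORNER `w′ = t`**: a package with
target `A^{κ,a,2,*}(u_k,w_k,t_k,z_k) · A♯^{2,a′}(t_k,z_k,w_{k+1},u_{k+1})` (residue `R′`, inner class `2`).
[cite: FitznerVanDerHofstad2017, §6.1 (6.4), "Case a = 0 / 1 / ≥ 2", "Case b = 1, ≥ 2" (arXiv:1506.07977v2 pp. 58–59); §5.1 (5.4) (p. 48); App. B (pp. 74–75); §4.4 (4.61), (4.64), text after (4.66) (pp. 41–42)] -/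
theorem nonempty_jPkg_midS_two_corner (i i₀ : Fin (M + 1)) (hk : i₀.succ = i.castSucc) (κ : Fin d × Bool)
    (hb : (b i.castSucc).2 = (b i.castSucc).1 + stepVec κ) (hσ : (τ i).1 = false) (hc2 : (τ i).2 = 2)
    (a₀ : Fin 3) (ha : a i.castSucc = Sum.inl a₀) {a' : Fin 3} (ha' : a i.succ = Sum.inl a') (ha'0 : a' ≠ 0)
    (hwt : w i.succ = t i.castSucc) :
    Nonempty (JPkg p (jctx M x b w t z a τ i.castSucc) (JFacts M x b w t z a c τ)
      (blockAiotaSt (Letters.perc d p) κ a₀ 2 (b i.castSucc).1 (w i.castSucc) (t i.castSucc) (z i.castSucc) *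
        blockASharp (Letters.perc d p) 2 a' (t i.castSucc) (z i.castSucc) (w i.succ) (b i.succ).1)) := by
  -- degenerate parameters: the piece is empty
  by_cases hP : (t i.castSucc ≠ (b i.succ).1 ∧ (a' ≠ 0 → w i.succ ≠ (b i.succ).1) ∧
      ((τ i).2 = 0 → t i.castSucc = z i.castSucc) ∧ ((τ i).2 = 1 → (zdGraph d).Adj (t i.castSucc) (z i.castSucc))) ∧
      (b i.castSucc).1 ≠ t i.castSucc ∧ (b i.castSucc).1 ≠ z i.castSucc ∧ (b i.castSucc).2 ≠ z i.castSucc ∧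
      (a₀ = 0 → w i.castSucc = (b i.castSucc).1) ∧ (a₀ = 1 → (zdGraph d).Adj (b i.castSucc).1 (w i.castSucc)) ∧
      t i.castSucc ≠ z i.castSucc
  swap
  · refine ⟨JPkg.vacuous p _ _ (fun ω K₀ hF => hP ?_) _⟩
    obtain ⟨-, hty, hut, huz, hvz, hw0, hw1, hw', -, hc0', hcn, hc1', -⟩ := midSOpen_facts hF i i₀ hk hσ ha ha'
    exact ⟨⟨hty, hw', hc0', fun h => (hc1' h).1⟩, hut, huz, hvz, hw0, hw1, hcn (by rw [hc2]; decide)⟩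
  obtain ⟨hQ, hut, huz, hvz, hw0, hw1, htz⟩ := hP
  obtain ⟨E3, E4, f3, f4, hmem₂, hrow₂⟩ :=
    midS_cornerLetter_piPerc p M x b w t z a c τ i hσ ha' ha'0 2 hwt hQ hc2
  refine nonempty_jPkg_midSOpen_core p M x b w t z a τ c i i₀ hk κ hb hσ ha ha'
    (event (ge 0) (b i.castSucc).2 (t i.castSucc)) (event (ge 2) (t i.castSucc) (z i.castSucc)) Set.univ E3 E4
    (endX a₀ (b i.castSucc).1 (w i.castSucc) (z i.castSucc))
    (isFinitary_event _ _ _) (isFinitary_event _ _ _) isFinitary_univ f3 f4 (isFinitary_endX _ _ _ _)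
    (fun ω K₀ hF => ⟨?_, ?_, Set.mem_univ _, (hmem₂ ω K₀ hF).1, (hmem₂ ω K₀ hF).2,
      midSOpen_exit_mem M x b w t z a c τ hF i i₀ hk ha huz hw0⟩) ?_ 
        ((junF_midSCorner_up_le₂ p M x b w t z a τ i hσ ha' _ _ _ _ _ _ _).trans hrow₂)
  · obtain ⟨h0, -⟩ := hF.conn_midS i hσ ha'
    rw [event_ge]; exact mem_openConnGe_zero_of_mem h0
  · obtain ⟨-, h1, -⟩ := hF.conn_midS i hσ ha'
    have hcl := (midSOpen_facts hF i i₀ hk hσ ha ha').2.2.2.2.2.2.2.2.2.2.2.2 hc2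
    rw [event_ge]
    exact mem_openConnGe_two_of_notMem h1 htz fun hm => hcl (hF.witness_subset _ 1 hm)
  · refine (junF_midSOpen_xb_le₄ p M x b w t z a τ i i₀ hk hσ ha ha' _ _ _ _ _ _ _).trans ?_
    unfold endX
    split_ifs with h0
    · subst h0
      rw [hw0 rfl]
      exact piPerc_midS_zero_two_le_blockAiotaSt p hb (fun h => hut h.symm) (fun h => huz h.symm) _
    · obtain h1 | h2 : a₀ = 1 ∨ a₀ = 2 := by
        fin_cases a₀
        · exact absurd rfl h0
        · exact Or.inl rfl
        · exact Or.inr rfl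
      · subst h1
        obtain ⟨κ', hκ'⟩ := (zdGraph_adj_iff_stepVec _ _).1 (hw1 rfl)
        exact piPerc_midS_one_two_le_blockAiotaSt p hb hκ' _
      · subst h2
        exact piPerc_midS_two_two_le_blockAiotaSt p hb _

/-- **THE CORNER CELL OF A MIDDLE JUNCTION** — the slot `hR′` of `NobleBoundsNDispatchReg.nonempty_jPkg_mid_reg`
(kind `false`, `a′ ≠ 0`, `w_{k+1} = t_k`) DISCHARGED against the Sharp payload: a package with target the
`R′`-slice `blockXRPrime L (τ i).2 = A'^{κ,a₀,c,*}(u_k,w_k,t_k,z_k) · A♯^{c,a′}(t_k,z_k,w_{k+1},u_{k+1})` for every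
regular class pair `(a₀, a′)` and every inner class `c = (τ i).2` (b2b-lace LEMMAS node N76-X2-D77, leaf T2a-mid).
[cite: FitznerVanDerHofstad2017, §6.1 (6.4), "Case a = 0 / 1 / ≥ 2", "Case b = 1, ≥ 2" (arXiv:1506.07977v2 pp. 58–59); §5.1 (5.4) (p. 48); App. B (pp. 74–75); §4.4 (4.61), (4.64), text after (4.66) (pp. 41–42)] -/
theorem nonempty_jPkg_midS_corner (i i₀ : Fin (M + 1)) (hk : i₀.succ = i.castSucc) (κ : Fin d × Bool)
    (hb : (b i.castSucc).2 = (b i.castSucc).1 + stepVec κ) (a₀ a' : Fin 3)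
    (ha : a i.castSucc = Sum.inl a₀) (ha' : a i.succ = Sum.inl a') (hσ : (τ i).1 = false) (ha'0 : a' ≠ 0)
    (hwt : w i.succ = t i.castSucc) :
    Nonempty (JPkg p (jctx M x b w t z a τ i.castSucc) (JFacts M x b w t z a c τ)
      (blockXRPrime (Letters.perc d p) (τ i).2 κ a₀ a' (b i.castSucc).1 (w i.castSucc) (t i.castSucc) (z i.castSucc)
        (w i.succ) (b i.succ).1)) := by
  unfold blockXRPrime
  have h3 : ∀ e : Fin 3, e = 0 ∨ e = 1 ∨ e = 2 := by decide
  rcases h3 (τ i).2 with hc | hc | hc <;> rw [hc]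
  · exact nonempty_jPkg_midS_zero_corner' p M x b w t z a c τ i i₀ hk κ hb hσ hc a₀ ha ha' ha'0 hwt
  · rw [blockAiotaSt'_of_ne _ _ (fun h => absurd h.2 (by decide))]
    exact nonempty_jPkg_midS_one_corner p M x b w t z a c τ i i₀ hk κ hb hσ hc a₀ ha ha' ha'0 hwt
  · rw [blockAiotaSt'_of_ne _ _ (fun h => absurd h.2 (by decide))]
    exact nonempty_jPkg_midS_two_corner p M x b w t z a c τ i i₀ hk κ hb hσ hc a₀ ha ha' ha'0 hwt


end Packages

end Summit.CriticalPhenomena.LaceExpansionHighD.NobleBlocks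

end
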